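import Literature.AlgebraicTopology.SingularHomology.LocallyFlatPairMapModel
import HarnessLib

/-!
# The class pulled back along a map of pairs which is a coordinate in one chart spans the supported line

Sequel of `SingularHomology/LocallyFlatCriticalDegree` (for a closed, connected, locally flat `S ⊆ Y`
of codimension `2`, `H₂(Y | S; R) = R · θ` and, over a field, `ker (H²(Y) → H²(Y ∖ S)) ≤ F · τ`).
This file identifies a GEOMETRIC generator of that line: the pull-back `Φ^* ω` of a point class along
a map `Φ : Y → P` sending `Y ∖ S` off a point `p₀` and reading, in ONE straightening chart
`e₀ : Y ⇀ ℂ × K₀` at a point of `S`, as `Φ = j (c · (e₀ ·).1)` (`j` an open embedding of the plane with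
`j 0 = p₀`, `c` continuous and nowhere zero) — the topological content of the Lelong–Poincaré formula
"`[D] = [f⁻¹(0)]` for a holomorphic `f` vanishing to order one along the divisor `D`" (C. Voisin,
*Hodge Theory and Complex Algebraic Geometry I* (2002), §11.1.2 and proof of Thm. 11.33; P. Griffiths,
J. Harris, *Principles of Algebraic Geometry* (1978), p. 141), in the support calculus of the coniveau
carriers (`HodgeTheory/AlgebraicClasses`: kernels of restriction maps) and for TOPOLOGICAL
straightenings:

* (model computations on the ball `B((0,y₀),r) ⊆ ℂ × K₀` — the first coordinate induces bijections,
  a rescaled first coordinate induces the same map, `H₂(ℂ | 0; R) ≅ R` — are in the companion file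
  `LocallyFlatPairMapModel`);
* `injective_map_of_isOpenEmbedding` — an open embedding of the plane induces injections
  `Hₙ(ℂ | 0) → Hₙ(P | j 0)` (excision);
* `exists_map_box_ne_zero` — in the local datum above, a box of `e₀` carries a class with non-zero
  image under `Φ|_{box} : (box, box ∖ S) → (P, P ∖ p₀)`;
* `ker_cohomologyMap_le_span_map_of_pairMap` — **MAIN: for `Y` second countable, `S` closed
  preconnected straightened in codimension `≥ 2`, `Φ(Y ∖ S) ⊆ P ∖ p₀` with the local datum at one
  point of `S`, and `ω ∈ H²(P; F)` dying on `P ∖ p₀` and pairing non-trivially with every class of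
  `H₂(P)` alive in `H₂(P | p₀)` (a point class of a `2`-sphere): every class of `H²(Y; F)` vanishing
  on `Y ∖ S` is a multiple of `Φ^* ω`.** Proof: such classes form a line (`LocallyFlatCriticalDegree`)
  containing `Φ^* ω`, which is non-zero because its functional `u ↦ ⟨ω, Φ_* u⟩` (universal
  coefficients) is non-zero on any `u₀ ∈ H₂(Y)` alive in `H₂(Y | S) = F · θ`, as
  `Φ_* : H₂(Y | S) → H₂(P | p₀)` is one-to-one on that line.

Everything is proved; no definitions, no named facts. Intended consumer: cup products with divisor
classes on the coniveau carrier (`HodgeTheory/AlgebraicClassesCup`, the moving hypothesis for a prime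
divisor: the class of a hypersurface section through the divisor has non-zero component along it).

## References

* [VoisinHodgeI2002] C. Voisin, Hodge Theory and Complex Algebraic Geometry I, CUP 2002, §11.1.2,
  Thm. 11.33 (proof).
* [GriffithsHarris1978] P. Griffiths, J. Harris, Principles of Algebraic Geometry, Wiley 1978, p. 141.
* [HatcherAT2002] A. Hatcher, Algebraic Topology, CUP 2002, §2.1 Prop. 2.19, Thm. 2.20, §3.1
  Thm. 3.2, §3.3 p. 231.
-/

noncomputable section

open CategoryTheory Limits Set TopologicalSpace Metric

universe u v

namespace Literature.AlgebraicTopology.SingularHomology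

variable (R : Type v) [CommRing R] (M : Type v) [AddCommGroup M] [Module R M]

section PairMapChart

variable {Y : Type} [TopologicalSpace Y] {S : Set Y}
variable {P : Type} [TopologicalSpace P] [T1Space P]
variable {K₀ : Type} [NormedAddCommGroup K₀] [NormedSpace ℝ K₀]

omit [NormedSpace ℝ K₀] in
/-- **An open embedding of the plane induces injections `H_n(ℂ | 0) → H_n(P | j 0)`** (the
homeomorphism onto the open image, then excision; Hatcher 2002, Thm. 2.20). [cite: HatcherAT2002, Thm. 2.20] -/
theorem injective_map_of_isOpenEmbedding {j : ℂ → P} (hj : Topology.IsOpenEmbedding j) {p₀ : P}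
    (hj0 : j 0 = p₀) (hjm : MapsTo (⟨j, hj.continuous⟩ : C(ℂ, P)) ({0}ᶜ : Set ℂ) ({p₀}ᶜ : Set P))
    (n : ℕ) : Function.Injective (relativeSingularHomology.map R M (⟨j, hj.continuous⟩ : C(ℂ, P)) hjm n) := by
  have hp₀ : p₀ ∈ range j := ⟨0, hj0⟩
  let j' : ℂ ≃ₜ ↥(range j) := hj.isEmbedding.toHomeomorph
  have hj' : ∀ z, ((j' z : ↥(range j)) : P) = j z := fun _ ↦ rfl
  have hpre : j' ⁻¹' ({⟨p₀, hp₀⟩}ᶜ : Set ↥(range j)) = ({0}ᶜ : Set ℂ) := by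
    ext z
    simp only [mem_preimage, mem_compl_iff, mem_singleton_iff]
    refine not_congr ⟨fun h ↦ hj.injective ?_, fun h ↦ Subtype.ext ?_⟩
    · rw [hj0, ← hj' z, h]
    · rw [hj' z, h, hj0]
  have hj'm : MapsTo (j' : C(ℂ, ↥(range j))) ({0}ᶜ : Set ℂ) ({⟨p₀, hp₀⟩}ᶜ : Set ↥(range j)) := by
    intro z hz
    rw [← hpre] at hz
    exact hz
  have h₁ := relativeSingularHomology.bijective_map_homeomorph R M j' hpre hj'm n
  haveI : IsIso (relativeSingularHomology.map R M _ hj'm n) :=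
    (LinearEquiv.ofBijective _ h₁).toModuleIso.isIso_hom
  have hincl := localHomology.mapsTo_subsetIncl_compl (X := P) hp₀
  haveI := localHomology.isIso_map_subsetIncl_of_isOpen R M hj.isOpen_range hp₀ n
  have key := LCube.relMap_congr R M (f := (⟨j, hj.continuous⟩ : C(ℂ, P)))
    (g := (subsetIncl (range j)).comp (j' : C(ℂ, ↥(range j))))
    (ContinuousMap.ext fun z ↦ (hj' z).symm) hjm (hincl.comp hj'm) n
  rw [key, relativeSingularHomology.map_comp R M _ _ hj'm hincl n]
  exact (ConcreteCategory.bijective_of_isIso (_ ≫ _)).1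

/-- **The local datum: a box of a chart in which `Φ` is a rescaled first coordinate carries a class
with non-zero image in `H_2(P | p₀)`.** Let `e₀ : Y ⇀ ℂ × K₀` straighten `S`, let
`B₀ = e₀.source ∩ e₀⁻¹ B((0,y₀),r)` be a box (`B((0,y₀),r) ⊆ e₀.target`), and suppose that on
`e₀.source` the map `Φ : Y → P` reads `Φ z = j (c z · (e₀ z).1)` with `j` an open embedding of the
plane, `j 0 = p₀`, and `c` continuous and nowhere zero on `e₀.source`. Then some class of
`H_2(B₀ | S; R)` (`R ≠ 0`) has non-zero image under `Φ|_{B₀} : (B₀, B₀ ∖ S) → (P, P ∖ p₀)`: through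
the chart this map is `j ∘ (rescaled first coordinate)`, i.e. up to homotopy of pairs
`j ∘ (first coordinate)` (`map_mul_fst_ball_eq`), a composite of bijections and an injection.
[cite: HatcherAT2002, §2.1 Prop. 2.19 and Thm. 2.20] -/
theorem exists_map_box_ne_zero [Nontrivial R] (e₀ : OpenPartialHomeomorph Y (ℂ × K₀))
    (he₀S : ∀ z ∈ e₀.source, z ∈ S ↔ (e₀ z).1 = 0) (y₀ : K₀) {r : ℝ} (hr : 0 < r)
    (hB : ball ((0 : ℂ), y₀) r ⊆ e₀.target) (Φ : C(Y, P)) {p₀ : P}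
    {j : ℂ → P} (hj : Topology.IsOpenEmbedding j) (hj0 : j 0 = p₀) {c : Y → ℂ}
    (hc : ContinuousOn c e₀.source) (hc0 : ∀ z ∈ e₀.source, c z ≠ 0)
    (hΦe : ∀ z ∈ e₀.source, Φ z = j (c z * (e₀ z).1))
    (hΦB : MapsTo (Φ.comp (subsetIncl (e₀.source ∩ e₀ ⁻¹' ball ((0 : ℂ), y₀) r)))
      (Subtype.val ⁻¹' S : Set ↥(e₀.source ∩ e₀ ⁻¹' ball ((0 : ℂ), y₀) r))ᶜ ({p₀}ᶜ : Set P)) :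
    ∃ x : localHomologyOfSet R R ↥(e₀.source ∩ e₀ ⁻¹' ball ((0 : ℂ), y₀) r) (Subtype.val ⁻¹' S) 2,
      relativeSingularHomology.map R R
        (Φ.comp (subsetIncl (e₀.source ∩ e₀ ⁻¹' ball ((0 : ℂ), y₀) r))) hΦB 2 x ≠ 0 := by
  set L : Set (ℂ × K₀) := {p | p.1 = 0} with hL
  -- the box homeomorphism
  set φ := e₀.homeomorphOfImageSubsetSource (s := e₀.source ∩ e₀ ⁻¹' ball ((0 : ℂ), y₀) r)
    inter_subset_left (image_box_eq e₀ y₀ hB) with hφdef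
  have hφ : ∀ z, ((φ z : ↥(ball ((0 : ℂ), y₀) r)) : ℂ × K₀) = e₀ z.1 := fun _ ↦ rfl
  have hφm := mapsTo_boxHomeomorph e₀ he₀S y₀ hB
  have hφbij := relativeSingularHomology.bijective_map_homeomorph R R φ
    (preimage_boxHomeomorph e₀ he₀S y₀ hB) hφm 2
  -- the rescaled first coordinate on the model ball
  have hCc : Continuous fun p : ↥(ball ((0 : ℂ), y₀) r) ↦ c (e₀.symm p.1) :=
    hc.comp_continuous (e₀.continuousOn_symm.comp_continuous continuous_subtype_val
      fun p ↦ hB p.2) fun p ↦ e₀.map_target (hB p.2)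
  let C : C(↥(ball ((0 : ℂ), y₀) r), ℂ) := ⟨fun p ↦ c (e₀.symm p.1), hCc⟩
  have hC : ∀ p, C p ≠ 0 := fun p ↦ hc0 _ (e₀.map_target (hB p.2))
  have hpr : MapsTo (fun p : ↥(ball ((0 : ℂ), y₀) r) ↦ p.1.1)
      (Subtype.val ⁻¹' L : Set ↥(ball ((0 : ℂ), y₀) r))ᶜ ({0}ᶜ : Set ℂ) := fun p hp h0 ↦ hp h0
  have hm : MapsTo (fun p : ↥(ball ((0 : ℂ), y₀) r) ↦ C p * p.1.1)
      (Subtype.val ⁻¹' L : Set ↥(ball ((0 : ℂ), y₀) r))ᶜ ({0}ᶜ : Set ℂ) := fun p hp h0 ↦ hp (by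
    simp only [mem_singleton_iff, mul_eq_zero, hC p, false_or] at h0
    exact h0)
  have hjm : MapsTo (⟨j, hj.continuous⟩ : C(ℂ, P)) ({0}ᶜ : Set ℂ) ({p₀}ᶜ : Set P) := by
    intro w hw h
    exact hw (hj.injective (by rw [hj0]; exact h))
  -- a class with non-zero first coordinate, pulled back to the box
  obtain ⟨x₀, hx₀⟩ := exists_map_fst_ball_ne_zero R (K₀ := K₀) y₀ hr hpr
  obtain ⟨x, rfl⟩ := hφbij.2 x₀
  refine ⟨x, fun h0 ↦ hx₀ ?_⟩
  -- `Φ|_{B₀} = j ∘ (C · fst) ∘ φ`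
  have key := LCube.relMap_congr R R
    (f := Φ.comp (subsetIncl (e₀.source ∩ e₀ ⁻¹' ball ((0 : ℂ), y₀) r)))
    (g := ((⟨j, hj.continuous⟩ : C(ℂ, P)).comp
      (⟨fun p ↦ C p * p.1.1, by fun_prop⟩ : C(↥(ball ((0 : ℂ), y₀) r), ℂ))).comp
      (φ : C(↥(e₀.source ∩ e₀ ⁻¹' ball ((0 : ℂ), y₀) r), ↥(ball ((0 : ℂ), y₀) r))))
    (ContinuousMap.ext fun z ↦ by
      change Φ z.1 = j (c (e₀.symm ((φ z : ↥(ball ((0 : ℂ), y₀) r)) : ℂ × K₀)) *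
        ((φ z : ↥(ball ((0 : ℂ), y₀) r)) : ℂ × K₀).1)
      rw [hφ z, e₀.left_inv z.2.1]
      exact hΦe z.1 z.2.1)
    hΦB ((hjm.comp hm).comp hφm) 2
  rw [key, relativeSingularHomology.map_comp R R _ _ hφm (hjm.comp hm) 2,
    relativeSingularHomology.map_comp R R _ _ hm hjm 2, ModuleCat.comp_apply, ModuleCat.comp_apply,
    map_mul_fst_ball_eq R R y₀ hr C hC hm hpr 2] at h0
  exact (injective_map_of_isOpenEmbedding R R hj hj0 hjm 2) (by rw [h0, map_zero])

end PairMapChart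

section PairMapLine

variable {Y : Type} [TopologicalSpace Y] {S : Set Y}
variable {P : Type} [TopologicalSpace P] [T1Space P]

/-- **The class pulled back along a map of pairs straight in one chart spans the supported line**
(the topological heart of the Lelong–Poincaré formula `[D] = [f⁻¹(0)]` for a holomorphic `f` with a
reduced zero along the divisor `D`, in the support calculus: C. Voisin, *Hodge Theory I*, §11.1.2 and
proof of Thm. 11.33; P. Griffiths, J. Harris, *Principles*, p. 141; here for singular homology over a
field and a topological codimension-`2` straightening). Let `Y` be second countable, `S ⊆ Y` closed
and preconnected, straightened by charts of normal dimension `≥ 2` (`hflat`), `Φ : Y → P` a map with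
`Φ(Y ∖ S) ⊆ P ∖ {p₀}`, and suppose that in ONE chart `e₀ : Y ⇀ ℂ × K₀` at a point of `S` the map
reads `Φ = j (c · (e₀ ·).1)` with `j` an open embedding of the plane, `j 0 = p₀`, `c` continuous and
nowhere zero. Let `ω ∈ H²(P; F)` pair non-trivially with every class of `H₂(P; F)` that survives in
`H₂(P | p₀)` (e.g. `P` a `2`-sphere, `ω ≠ 0`). Then every class of `H²(Y; F)` vanishing on `Y ∖ S` is
a multiple of `Φ^* ω`. Proof: such a class is a functional on `H₂(Y)` killing the image of
`H₂(Y ∖ S)`, i.e. factoring through the image of `H₂(Y) → H₂(Y | S) = F · θ`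
(`exists_forall_mem_span_localHomologyOfSet_of_locallyFlat`); the functional of `Φ^* ω` is
`u ↦ ⟨ω, Φ_* u⟩`, non-zero on any `u₀` with `u₀|_S ≠ 0` because `Φ_* : H₂(Y | S) → H₂(P | p₀)` is
one-to-one on `F · θ` (it is non-zero on the class of a box, `exists_map_box_ne_zero`).
[cite: VoisinHodgeI2002, §11.1.2 and Thm. 11.33 (proof)] [cite: HatcherAT2002, §3.1 Thm. 3.2, §2.1 Prop. 2.19, Thm. 2.20] -/
theorem ker_cohomologyMap_le_span_map_of_pairMap [SecondCountableTopology Y] (F : Type) [Field F]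
    (hS : IsClosed S) (hSc : IsPreconnected S)
    (hflat : ∀ x ∈ S, ∃ (E : Type) (_ : NormedAddCommGroup E) (_ : NormedSpace ℝ E)
      (_ : FiniteDimensional ℝ E) (K : Type) (_ : NormedAddCommGroup K) (_ : NormedSpace ℝ K)
      (e : OpenPartialHomeomorph Y (E × K)),
      2 ≤ Module.finrank ℝ E ∧ x ∈ e.source ∧ ∀ z ∈ e.source, z ∈ S ↔ (e z).1 = 0)
    (Φ : C(Y, P)) {p₀ : P} (hΦ : MapsTo Φ Sᶜ ({p₀}ᶜ : Set P))
    (ω : singularCohomology F F P 2) (hω0 : singularCohomology.map F F (subsetIncl ({p₀}ᶜ : Set P)) 2 ω = 0)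
    (hω : ∀ u : singularHomology F F P 2,
      relativeSingularHomology.ofAbsolute F F P ({p₀}ᶜ : Set P) 2 u ≠ 0 → kroneckerPairing F F P 2 ω u ≠ 0)
    {K₀ : Type} [NormedAddCommGroup K₀] [NormedSpace ℝ K₀] (e₀ : OpenPartialHomeomorph Y (ℂ × K₀))
    (he₀S : ∀ z ∈ e₀.source, z ∈ S ↔ (e₀ z).1 = 0) {s₀ : Y} (hs₀ : s₀ ∈ e₀.source) (hs₀S : s₀ ∈ S)
    {j : ℂ → P} (hj : Topology.IsOpenEmbedding j) (hj0 : j 0 = p₀) {c : Y → ℂ}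
    (hc : ContinuousOn c e₀.source) (hc0 : ∀ z ∈ e₀.source, c z ≠ 0)
    (hΦe : ∀ z ∈ e₀.source, Φ z = j (c z * (e₀ z).1)) :
    LinearMap.ker (singularCohomology.map F F (subsetIncl Sᶜ) 2).hom ≤
      Submodule.span F {singularCohomology.map F F Φ 2 ω} := by
  -- the line `H₂(Y | S) = F · θ`
  obtain ⟨θ, hθ⟩ := exists_forall_mem_span_localHomologyOfSet_of_locallyFlat F hS hSc (k := 2) le_rfl hflat
  set q := relativeSingularHomology.ofAbsolute F F Y Sᶜ 2 with hq
  set κ := kroneckerPairing F F Y 2 with hκ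
  have hκinj := kroneckerPairing_injective_of_field F Y 2
  have hex : ∀ u : singularHomology F F Y 2, q u = 0 →
      ∃ w, singularHomology.map F F (subsetIncl Sᶜ) 2 w = u := fun u hu ↦
    ((ShortComplex.moduleCat_exact_iff _).1
      (relativeSingularHomology.exact_map_ofAbsolute F F (X := Y) Sᶜ 2)) u hu
  have hvan : ∀ x ∈ LinearMap.ker (singularCohomology.map F F (subsetIncl Sᶜ) 2).hom,
      ∀ u : singularHomology F F Y 2, q u = 0 → κ x u = 0 := by
    intro x hx u hu
    obtain ⟨w, rfl⟩ := hex u hu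
    rw [hκ, ← kroneckerPairing_map, LinearMap.mem_ker.1 hx, map_zero, LinearMap.zero_apply]
  -- the class `Φ^* ω` dies on `Y ∖ S`
  set ψ := singularCohomology.map F F Φ 2 ω with hψ
  -- `Φ_*` on `H₂(Y | S)` is one-to-one: it is non-zero on the class of a small box at `s₀`
  have hΦinj : ∀ d : localHomologyOfSet F F Y S 2,
      relativeSingularHomology.map F F Φ hΦ 2 d = 0 → d = 0 := by
    -- a box of `e₀` at `s₀`
    obtain ⟨r, hr0, -, hBt, -, -⟩ := exists_box_subset e₀ he₀S hs₀S hs₀ isOpen_univ (mem_univ _)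
      zero_lt_one
    have hΦB : MapsTo (Φ.comp (subsetIncl (e₀.source ∩ e₀ ⁻¹' ball ((0 : ℂ), (e₀ s₀).2) r)))
        (Subtype.val ⁻¹' S : Set ↥(e₀.source ∩ e₀ ⁻¹' ball ((0 : ℂ), (e₀ s₀).2) r))ᶜ ({p₀}ᶜ : Set P) :=
      fun z hz ↦ hΦ hz
    obtain ⟨x, hx⟩ := exists_map_box_ne_zero F e₀ he₀S (e₀ s₀).2 hr0 hBt Φ hj hj0 hc hc0 hΦe hΦB
    -- its image `d₀` in `H₂(Y | S)` has `Φ_* d₀ ≠ 0`; every `d` is a multiple of `d₀`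
    set d₀ := localHomologyOfSet.toAmbient F F S _ 2 x with hd₀
    have hd₀ne : relativeSingularHomology.map F F Φ hΦ 2 d₀ ≠ 0 := by
      rw [hd₀, localHomologyOfSet.toAmbient, ← ModuleCat.comp_apply,
        ← relativeSingularHomology.map_comp]
      exact hx
    have hθne : relativeSingularHomology.map F F Φ hΦ 2 θ ≠ 0 := by
      obtain ⟨a, ha⟩ := Submodule.mem_span_singleton.1 (hθ d₀)
      intro h
      apply hd₀ne
      rw [← ha, map_smul, h, smul_zero]
    intro d hd
    obtain ⟨b, rfl⟩ := Submodule.mem_span_singleton.1 (hθ d)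
    rw [map_smul, smul_eq_zero] at hd
    rcases hd with rfl | h
    · exact zero_smul _ _
    · exact absurd h hθne
  -- conclusion
  by_cases hK : ∀ u : singularHomology F F Y 2, q u = 0
  · -- every class of `H₂(Y)` dies in `H₂(Y | S)`: the kernel is `0`
    intro x hx
    have h0 : x = 0 := hκinj (LinearMap.ext fun u ↦ by
      rw [map_zero, LinearMap.zero_apply]
      exact hvan x hx u (hK u))
    rw [h0]
    exact Submodule.zero_mem _
  push Not at hK
  obtain ⟨u₀, hu₀⟩ := hK
  -- `⟨ψ, u₀⟩ ≠ 0`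
  have hψu₀ : κ ψ u₀ ≠ 0 := by
    rw [hκ, hψ, kroneckerPairing_map]
    apply hω
    intro h
    apply hu₀
    apply hΦinj
    rw [← ModuleCat.comp_apply, ← relativeSingularHomology.ofAbsolute_comp_map, ModuleCat.comp_apply]
      at h
    exact h
  have hψK : ψ ∈ LinearMap.ker (singularCohomology.map F F (subsetIncl Sᶜ) 2).hom := by
    -- `Φ` restricts to `Φ' : Y ∖ S → P ∖ p₀`, and `ω` dies on `P ∖ p₀`
    let Φ' : C(↥Sᶜ, ↥({p₀}ᶜ : Set P)) := ⟨fun z ↦ ⟨Φ z.1, hΦ z.2⟩, by fun_prop⟩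
    have hfac : Φ.comp (subsetIncl Sᶜ) = (subsetIncl ({p₀}ᶜ : Set P)).comp Φ' := rfl
    rw [LinearMap.mem_ker, hψ]
    change (singularCohomology.map F F Φ 2 ≫ singularCohomology.map F F (subsetIncl Sᶜ) 2) ω = 0
    rw [← singularCohomology.map_comp, hfac, singularCohomology.map_comp, ModuleCat.comp_apply, hω0,
      map_zero]
  have hψne : ψ ≠ 0 := fun h ↦ hψu₀ (by rw [h, map_zero, LinearMap.zero_apply])
  -- the kernel is a line containing the non-zero `ψ`
  obtain ⟨τ, hτ⟩ := exists_ker_cohomologyMap_le_span_of_localHomologyOfSet F S 2 ⟨θ, hθ⟩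
  obtain ⟨a, ha⟩ := Submodule.mem_span_singleton.1 (hτ hψK)
  have ha0 : a ≠ 0 := by
    rintro rfl
    rw [zero_smul] at ha
    exact hψne ha.symm
  refine hτ.trans ((Submodule.span_singleton_le_iff_mem _ _).2 ?_)
  refine Submodule.mem_span_singleton.2 ⟨a⁻¹, ?_⟩
  rw [← ha, smul_smul, inv_mul_cancel₀ ha0, one_smul]

end PairMapLine



end Literature.AlgebraicTopology.SingularHomology

end
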